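import Summits.CriticalPhenomena.SAWScalingLimit.Theorems.SAWRenewalTightnessRoomEntropyDefs
import Literature.Probability.RandomPlanarGeometry.LoewnerRoomObservableAdapted
import Literature.Probability.RandomPlanarGeometry.LoewnerDriverStability
import Literature.Probability.RandomPlanarGeometry.LoewnerDriverUniformStability
import Literature.Probability.RandomPlanarGeometry.LoewnerDerivRatio
import Mathlib.Topology.UniformSpace.CompactConvergence
import HarnessLib

/-!
# `stub_roomObsFunctional`: the stopped room–entropy observable as a path functional

Stub `stub_roomObsFunctional` of the registered skeleton (r4) of the line
`room-entropy-wright-fisher` for the crux `SubseqIdentification` (stmt-CriticalPhenomena-0783,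
route `SAWRenewalTightness`, shared with `SAWParafermion` / `SAWLeftRightFKG` /
`SAWAsymptoticMorera`; vocabulary `Theorems/SAWRenewalTightnessRoomEntropyDefs.lean`).

For `w ∈ ℍ` and a cap `m`, the stopped room–entropy observable
`N^{w,m}_u(W) = log ψ_{u∧τ}(w) + 3 H(S_{u∧τ}(w))` (`roomObsStopped W w m u`; `ψ` =
`Loewner.derivRatio`, `S` = `Loewner.schrammObs`, `τ = roomStop W w m`) is jointly continuous in
`(u, W) ∈ [0, ∞) × C([0, ∞), ℝ)` (compact-open topology) and bounded by `2 log (m+1) + 3 log 2`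
for every continuous driver: the hypotheses `hN`, `hNC` of the tree's abstract passage theorem
`Loewner.integral_cylinder_eq_zero_of_tendstoInDistribution`, consumed by the proof of the
neighbouring stub `stub_roomPassage`.

Proof. Boundedness: `Loewner.abs_roomObs_min_roomStop_le`. Joint continuity at `(u₀, W₀)`:
driver stability uniformly up to a time `b ∈ (τ(W₀), T_w(W₀))` in the compact-open topology
(`eventually_close`, Kemppainen–Smirnov's Lemma 5.4 =
`Loewner.tendstoUniformlyOn_map_of_tendstoUniformlyOn_driving`); continuity of the room stop in
the driver (`continuous_roomStop`: margin above the level strictly before `τ₀`; if `τ₀ < m + 1`,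
STRICT decrease of the height after `τ₀`, `im_centredMap_lt`, from the cocycle `Loewner.map_add`
and `Loewner.im_map_lt`); whence the stopped centred flow is jointly continuous and nonzero
(`continuous_centredMap_stopped`), so `S = (1 + Re z/|z|)/2` is continuous, and
`log ψ_{u∧τ} = ∫₀^{u∧τ} 4y²/|z|⁴` (Rohde–Schramm (6.3), `Loewner.derivRatio_eq_exp`) is jointly
continuous (`continuous_log_derivRatio_stopped`: uniform continuity of the rate on a compact set
of values away from `0`). No named fact; axioms `propext`, `Classical.choice`, `Quot.sound`.

References: S. Rohde, O. Schramm, Ann. of Math. 161 (2005), eq. (6.3), Lemma 6.3; A. Kemppainen,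
S. Smirnov, Ann. Probab. 45 (2017), App. A, Lemma 5.4; G. F. Lawler (2005), §4.7, Prop. 4.47.
-/

noncomputable section

open MeasureTheory Filter Topology Set
open scoped NNReal ENNReal Classical BigOperators
open Literature.Probability.LatticeModels
open Literature.Probability.RandomPlanarGeometry
open UpperHalfPlane (upperHalfPlaneSet)

namespace Summit.CriticalPhenomena.SAWScalingLimit.Theorems.SubseqIdentification.RoomEntropy

/-! ## Driver stability in the compact-open topology -/

/-- **Driver stability, uniformly up to a fixed time, in the compact-open topology**: if `w`
flows beyond `b` for the driver `W₀`, then every driver `W` close enough to `W₀` in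
`C([0, ∞), ℝ)` flows `w` beyond `b`, with centred flows `ε`-close on `[0, b]`
(Kemppainen–Smirnov, Lemma 5.4: `Loewner.tendstoUniformlyOn_map_of_tendstoUniformlyOn_driving`).
[cite: KemppainenSmirnov2017, App. A, Lemma 5.4] -/
theorem eventually_close (W₀ : C(ℝ≥0, ℝ)) (w : ℂ) {b : ℝ≥0}
    (hb : (b : WithTop ℝ≥0) < Loewner.swallowingTime W₀ w) {ε : ℝ} (hε : 0 < ε) :
    ∀ᶠ W : C(ℝ≥0, ℝ) in 𝓝 W₀, (b : WithTop ℝ≥0) < Loewner.swallowingTime W w ∧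
      ∀ s : ℝ≥0, s ≤ b →
        dist (Loewner.centredMap W s w) (Loewner.centredMap W₀ s w) < ε := by
  have hconv : TendstoUniformlyOn (fun (W : C(ℝ≥0, ℝ)) (s : ℝ≥0) ↦ W s) W₀ (𝓝 W₀) (Iic b) :=
    ((ContinuousMap.tendsto_iff_forall_isCompact_tendstoUniformlyOn.1 tendsto_id) (Icc 0 b)
      isCompact_Icc).mono fun s hs ↦ ⟨zero_le, hs⟩
  have hWn : ∀ᶠ W : C(ℝ≥0, ℝ) in 𝓝 W₀, Continuous (W : ℝ≥0 → ℝ) :=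
    Eventually.of_forall fun W ↦ W.continuous
  have hKb : ∀ z ∈ ({w} : Set ℂ), (b : WithTop ℝ≥0) < Loewner.swallowingTime W₀ z :=
    fun z hz ↦ by rwa [mem_singleton_iff.1 hz]
  have h1 := Loewner.eventually_forall_lt_swallowingTime_of_tendstoUniformlyOn_driving
    W₀.continuous hWn hconv isCompact_singleton hKb
  have h2 := Metric.tendstoUniformlyOn_iff.1
    (Loewner.tendstoUniformlyOn_map_of_tendstoUniformlyOn_driving W₀.continuous hWn hconv
      isCompact_singleton hKb) (ε / 2) (half_pos hε)
  have h3 := Metric.tendstoUniformlyOn_iff.1 hconv (ε / 2) (half_pos hε)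
  filter_upwards [h1, h2, h3] with W hW1 hW2 hW3
  refine ⟨hW1 w (mem_singleton w), fun s hs ↦ ?_⟩
  have ha : dist (Loewner.map W₀ s w) (Loewner.map W s w) < ε / 2 := hW2 (s, w) ⟨hs, rfl⟩
  rw [Loewner.centredMap_apply, Loewner.centredMap_apply, dist_eq_norm]
  calc ‖(Loewner.map W s w - W s) - (Loewner.map W₀ s w - W₀ s)‖
      = ‖(Loewner.map W s w - Loewner.map W₀ s w) - ((W s : ℂ) - W₀ s)‖ := by ring_nf
    _ ≤ ‖Loewner.map W s w - Loewner.map W₀ s w‖ + ‖(W s : ℂ) - W₀ s‖ := norm_sub_le _ _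
    _ = dist (Loewner.map W₀ s w) (Loewner.map W s w) + dist (W₀ s) (W s) := by
        rw [dist_comm, dist_eq_norm, dist_comm (W₀ s), Real.dist_eq, ← Complex.ofReal_sub,
          Complex.norm_real, Real.norm_eq_abs]
    _ < ε / 2 + ε / 2 := add_lt_add ha (hW3 s hs)
    _ = ε := add_halves ε

/-! ## The room stop is a continuous functional of the driver -/

/-- There is a time strictly between the room stop and the swallowing time. [folklore] -/
theorem exists_roomStop_lt {W₀ : ℝ≥0 → ℝ} (hW₀ : Continuous W₀) {w : ℂ} (hw : 0 < w.im) (m : ℕ) :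
    ∃ b : ℝ≥0, roomStop W₀ w m < b ∧ (b : WithTop ℝ≥0) < Loewner.swallowingTime W₀ w := by
  obtain ⟨a, ha1, ha2⟩ := exists_between (Loewner.coe_roomStop_lt_swallowingTime hW₀ hw m)
  obtain ⟨b, rfl⟩ := WithTop.ne_top_iff_exists.1 (ne_top_of_lt ha2)
  exact ⟨b, WithTop.coe_lt_coe.1 ha1, ha2⟩

/-- **The height of the centred flow is strictly decreasing** before the swallowing time:
`Im z_t < Im z_s` for `s < t < T_w` (`∂_t Im g_t = -2 Im g_t/|g_t - W_t|² < 0`; here from the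
cocycle `g_t = g^{W(s+·)}_{t-s} ∘ g_s`, `Loewner.map_add`, and `Loewner.im_map_lt`). [folklore] -/
theorem im_centredMap_lt {W : ℝ≥0 → ℝ} (hW : Continuous W) {w : ℂ} (hw : 0 < w.im)
    {s t : ℝ≥0} (hst : s < t) (ht : (t : WithTop ℝ≥0) < Loewner.swallowingTime W w) :
    (Loewner.centredMap W t w).im < (Loewner.centredMap W s w).im := by
  have hs : (s : WithTop ℝ≥0) < Loewner.swallowingTime W w :=
    lt_of_le_of_lt (WithTop.coe_le_coe.2 hst.le) ht
  obtain ⟨r, rfl⟩ : ∃ r, t = s + r := ⟨t - s, (add_tsub_cancel_of_le hst.le).symm⟩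
  have hr0 : 0 < r := by simpa using hst
  obtain ⟨hrT, hmap⟩ := Loewner.map_add hW ht
  rw [Loewner.im_centredMap, Loewner.im_centredMap, hmap]
  refine Loewner.im_map_lt (Loewner.continuous_shift _ hW s) hr0 ?_
  rw [Loewner.mem_domain_iff]
  exact ⟨Loewner.mapsTo_map hW s ((Loewner.mem_domain_iff W s w).2 ⟨hw, hs⟩), hrT⟩

/-- The imaginary parts of two `c`-close complex numbers differ by less than `c`. [folklore] -/
theorem abs_im_sub_im_lt {Z Z' : ℂ} {c : ℝ} (h : dist Z Z' < c) : |Z.im - Z'.im| < c := by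
  calc |Z.im - Z'.im| = |(Z - Z').im| := by rw [Complex.sub_im]
    _ ≤ ‖Z - Z'‖ := Complex.abs_im_le_norm _
    _ = dist Z Z' := (dist_eq_norm _ _).symm
    _ < c := h

/-- **The room stop `τ^{w,m}` is a continuous functional of the driving function** on
`C([0, ∞), ℝ)` (`Im w > 0`). Lower semicontinuity: strictly before `τ₀ = τ(W₀)` the height of
`W₀`'s flow exceeds the level `Im w/(m+1)` with a margin, which nearby drivers respect. Upper
semicontinuity: either the cap `m + 1` bounds every room stop, or `τ₀ < m + 1`, the height at `τ₀`
is `≤` the level and strictly below it at every later time (strict decrease), which nearby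
drivers see. [folklore] -/
theorem continuous_roomStop {w : ℂ} (hw : 0 < w.im) (m : ℕ) :
    Continuous fun W : C(ℝ≥0, ℝ) ↦ roomStop W w m := by
  refine continuous_iff_continuousAt.2 fun W₀ ↦ ?_
  rw [ContinuousAt, tendsto_order]
  set τ₀ := roomStop W₀ w m with hτ₀
  have hτT : (τ₀ : WithTop ℝ≥0) < Loewner.swallowingTime W₀ w :=
    Loewner.coe_roomStop_lt_swallowingTime W₀.continuous hw m
  constructor
  · -- lower semicontinuity
    intro a ha
    obtain ⟨a', haa', ha'τ⟩ := exists_between ha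
    have ha'T : (a' : WithTop ℝ≥0) < Loewner.swallowingTime W₀ w :=
      lt_of_le_of_lt (WithTop.coe_le_coe.2 ha'τ.le) hτT
    have hlev : w.im / ((m : ℝ) + 1) < (Loewner.centredMap W₀ a' w).im :=
      Loewner.lt_im_centredMap_of_lt_roomStop W₀ w m ha'τ
    have hc0 : 0 < (Loewner.centredMap W₀ a' w).im - w.im / ((m : ℝ) + 1) := sub_pos.2 hlev
    filter_upwards [eventually_close W₀ w ha'T hc0] with W hW
    obtain ⟨-, hclose⟩ := hW
    refine haa'.trans_le (le_csInf ⟨(m : ℝ≥0) + 1, Or.inr rfl⟩ ?_)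
    rintro t (ht | ht)
    · refine not_lt.1 fun hlt ↦ ?_
      have h3 : (Loewner.centredMap W t w).im ≤ w.im / ((m : ℝ) + 1) := ht
      linarith [(abs_lt.1 (abs_im_sub_im_lt (hclose t hlt.le))).1,
        Loewner.im_centredMap_antitone W₀.continuous hw hlt.le ha'T]
    · rw [mem_singleton_iff.1 ht]
      exact ha'τ.le.trans (Loewner.roomStop_le W₀ w m)
  · -- upper semicontinuity
    intro a ha
    by_cases hcap : (m : ℝ≥0) + 1 < a
    · exact Eventually.of_forall fun W ↦ (Loewner.roomStop_le W w m).trans_lt hcap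
    rw [not_lt] at hcap
    have hτm : τ₀ < (m : ℝ≥0) + 1 := ha.trans_le hcap
    -- the height at `τ₀` is at most the level
    have hYτ : (Loewner.centredMap W₀ τ₀ w).im ≤ w.im / ((m : ℝ) + 1) := by
      rcases (Loewner.roomStop_le_iff W₀.continuous hw m τ₀).1 le_rfl with h | h | h
      · exact absurd h (not_le.2 hτm)
      · exact absurd hτT h
      · exact h
    -- a time `a' ∈ (τ₀, a)` before the swallowing time
    obtain ⟨a₁, h₁, h₁'⟩ := exists_between (lt_min (WithTop.coe_lt_coe.2 ha) hτT)
    obtain ⟨a', rfl⟩ := WithTop.ne_top_iff_exists.1 (ne_top_of_lt (h₁'.trans_le (min_le_left _ _)))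
    have hτa' : τ₀ < a' := WithTop.coe_lt_coe.1 h₁
    have ha'a : a' < a := WithTop.coe_lt_coe.1 (h₁'.trans_le (min_le_left _ _))
    have ha'T : (a' : WithTop ℝ≥0) < Loewner.swallowingTime W₀ w := h₁'.trans_le (min_le_right _ _)
    have hlt : (Loewner.centredMap W₀ a' w).im < w.im / ((m : ℝ) + 1) :=
      (im_centredMap_lt W₀.continuous hw hτa' ha'T).trans_le hYτ
    have hc0 : 0 < w.im / ((m : ℝ) + 1) - (Loewner.centredMap W₀ a' w).im := sub_pos.2 hlt
    filter_upwards [eventually_close W₀ w ha'T hc0] with W hW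
    obtain ⟨-, hclose⟩ := hW
    refine lt_of_le_of_lt (csInf_le (OrderBot.bddBelow _) (Or.inl ?_)) ha'a
    show (Loewner.centredMap W a' w).im ≤ w.im / ((m : ℝ) + 1)
    linarith [(abs_lt.1 (abs_im_sub_im_lt (hclose a' le_rfl))).2]

/-! ## Joint continuity of the stopped centred flow and of the stopped `log ψ` -/

/-- **The stopped centred flow `(u, W) ↦ z_{u ∧ τ(W)}(W)` is jointly continuous** on
`[0, ∞) × C([0, ∞), ℝ)`: continuity of the stopped time (`continuous_roomStop`), continuity in
time of `W₀`'s flow (`Loewner.continuousOn_centredMap`) and driver stability up to a time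
`b ∈ (τ(W₀), T_w(W₀))` (`eventually_close`). [folklore] -/
theorem continuous_centredMap_stopped {w : ℂ} (hw : 0 < w.im) (m : ℕ) :
    Continuous fun p : ℝ≥0 × C(ℝ≥0, ℝ) ↦
      Loewner.centredMap p.2 (min p.1 (roomStop p.2 w m)) w := by
  have hr : Continuous fun p : ℝ≥0 × C(ℝ≥0, ℝ) ↦ min p.1 (roomStop p.2 w m) :=
    continuous_fst.min ((continuous_roomStop hw m).comp continuous_snd)
  refine continuous_iff_continuousAt.2 fun p₀ ↦ ?_
  obtain ⟨u₀, W₀⟩ := p₀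
  set r : ℝ≥0 × C(ℝ≥0, ℝ) → ℝ≥0 := fun p ↦ min p.1 (roomStop p.2 w m) with hrdef
  obtain ⟨b, hτb, hbT⟩ := exists_roomStop_lt W₀.continuous hw m
  have hr₀b : r (u₀, W₀) < b := (min_le_right _ _).trans_lt hτb
  have hrc : ContinuousAt r (u₀, W₀) := hr.continuousAt
  -- continuity in time at the base driver
  have hZ : ContinuousAt (fun s : ℝ≥0 ↦ Loewner.centredMap W₀ s w) (r (u₀, W₀)) := by
    refine (Loewner.continuousOn_centredMap W₀.continuous
      (Loewner.ne_driving_of_im_pos hw 0)).continuousAt ?_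
    exact mem_of_superset (Iio_mem_nhds hr₀b) fun s hs ↦
      lt_of_le_of_lt (WithTop.coe_le_coe.2 (le_of_lt hs)) hbT
  have h1 : Tendsto (fun p ↦ Loewner.centredMap W₀ (r p) w) (𝓝 (u₀, W₀))
      (𝓝 (Loewner.centredMap W₀ (r (u₀, W₀)) w)) := hZ.tendsto.comp hrc
  rw [ContinuousAt, Metric.tendsto_nhds]
  intro ε hε
  have h1' := Metric.tendsto_nhds.1 h1 (ε / 2) (half_pos hε)
  have h2 : ∀ᶠ p : ℝ≥0 × C(ℝ≥0, ℝ) in 𝓝 (u₀, W₀), r p < b :=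
    hrc.tendsto.eventually (eventually_lt_nhds hr₀b)
  have h3 : ∀ᶠ p : ℝ≥0 × C(ℝ≥0, ℝ) in 𝓝 (u₀, W₀),
      (b : WithTop ℝ≥0) < Loewner.swallowingTime p.2 w ∧ ∀ s : ℝ≥0, s ≤ b →
        dist (Loewner.centredMap p.2 s w) (Loewner.centredMap W₀ s w) < ε / 2 :=
    (continuous_snd.tendsto (u₀, W₀)).eventually (eventually_close W₀ w hbT (half_pos hε))
  filter_upwards [h1', h2, h3] with p hp1 hp2 hp3
  obtain ⟨-, hclose⟩ := hp3
  calc dist (Loewner.centredMap p.2 (r p) w) (Loewner.centredMap W₀ (r (u₀, W₀)) w)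
      ≤ dist (Loewner.centredMap p.2 (r p) w) (Loewner.centredMap W₀ (r p) w) +
          dist (Loewner.centredMap W₀ (r p) w) (Loewner.centredMap W₀ (r (u₀, W₀)) w) :=
        dist_triangle _ _ _
    _ < ε / 2 + ε / 2 := add_lt_add (hclose (r p) hp2.le) hp1
    _ = ε := add_halves ε

/-- **The stopped loss of log conformal radius `(u, W) ↦ log ψ_{u ∧ τ(W)}(W)` is jointly
continuous** on `[0, ∞) × C([0, ∞), ℝ)`: by Rohde–Schramm's (6.3), `log ψ_r = ∫₀ʳ 4y²/|z|⁴`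
(`Loewner.derivRatio_eq_exp`) for `r < T_w`; the primitive is continuous in `r`, and the rate
`4 (Im z)²/|z|⁴` is uniformly continuous on a compact set of values away from `0` containing the
flows of all drivers near `W₀` up to a time `b ∈ (τ(W₀), T_w(W₀))` (the height of `W₀`'s flow is
positive and non-increasing on `[0, b]`; driver stability `eventually_close`).
[cite: RohdeSchramm2005, eq. (6.3)] -/
theorem continuous_log_derivRatio_stopped {w : ℂ} (hw : 0 < w.im) (m : ℕ) :
    Continuous fun p : ℝ≥0 × C(ℝ≥0, ℝ) ↦
      Real.log (Loewner.derivRatio p.2 w (min p.1 (roomStop p.2 w m))) := by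
  have hr : Continuous fun p : ℝ≥0 × C(ℝ≥0, ℝ) ↦ min p.1 (roomStop p.2 w m) :=
    continuous_fst.min ((continuous_roomStop hw m).comp continuous_snd)
  refine continuous_iff_continuousAt.2 fun p₀ ↦ ?_
  obtain ⟨u₀, W₀⟩ := p₀
  set r : ℝ≥0 × C(ℝ≥0, ℝ) → ℝ≥0 := fun p ↦ min p.1 (roomStop p.2 w m) with hrdef
  obtain ⟨b, hτb, hbT⟩ := exists_roomStop_lt W₀.continuous hw m
  have hr₀b : r (u₀, W₀) < b := (min_le_right _ _).trans_lt hτb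
  have hrc : ContinuousAt r (u₀, W₀) := hr.continuousAt
  have hbT' : (((b : ℝ)).toNNReal : WithTop ℝ≥0) < Loewner.swallowingTime W₀ w := by
    rwa [Real.toNNReal_coe]
  -- the primitive of the rate at `W₀` is continuous on `[0, b]`
  set F₀ : ℝ → ℝ := Loewner.derivRatioRate W₀ w with hF₀
  have hprim : ContinuousOn (fun x : ℝ ↦ ∫ s in (0 : ℝ)..x, F₀ s) (Icc (0 : ℝ) b) := by
    have h1 := intervalIntegral.continuousOn_primitive_interval (μ := volume) (f := F₀) (a := 0)
      (b := (b : ℝ)) ?_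
    · rwa [uIcc_of_le b.coe_nonneg] at h1
    · rw [uIcc_of_le b.coe_nonneg]
      exact (Loewner.continuousOn_derivRatioRate W₀.continuous hbT').integrableOn_compact
        isCompact_Icc
  set P : ℝ≥0 → ℝ := fun x ↦ ∫ s in (0 : ℝ)..(x : ℝ), F₀ s with hP
  have hPc : ContinuousAt P (r (u₀, W₀)) := by
    have h1 : ContinuousOn P (Iic b) :=
      hprim.comp NNReal.continuous_coe.continuousOn fun x hx ↦
        ⟨x.coe_nonneg, NNReal.coe_le_coe.2 hx⟩
    exact h1.continuousAt (mem_of_superset (Iio_mem_nhds hr₀b) fun s hs ↦ mem_Iic.2 (le_of_lt hs))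
  have h1 : Tendsto (fun p ↦ P (r p)) (𝓝 (u₀, W₀)) (𝓝 (P (r (u₀, W₀)))) := hPc.tendsto.comp hrc
  -- the base flow on `[0, b]`: continuous, bounded by `R`, height `≥ 2a > 0`
  set Z₀ : ℝ≥0 → ℂ := fun s ↦ Loewner.centredMap W₀ s w with hZ₀
  have hZ₀c : ContinuousOn Z₀ (Icc 0 b) :=
    (Loewner.continuousOn_centredMap W₀.continuous (Loewner.ne_driving_of_im_pos hw 0)).mono
      fun s hs ↦ lt_of_le_of_lt (WithTop.coe_le_coe.2 hs.2) hbT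
  obtain ⟨R, hR⟩ := isCompact_Icc.exists_bound_of_continuousOn hZ₀c
  have hR' : ∀ s : ℝ≥0, s ≤ b → ‖Z₀ s‖ ≤ R := fun s hs ↦ hR s ⟨zero_le, hs⟩
  set a : ℝ := (Z₀ b).im / 2 with ha
  have ha0 : 0 < a := half_pos (Loewner.im_centredMap_pos W₀.continuous hw hbT)
  have hIm : ∀ s : ℝ≥0, s ≤ b → 2 * a ≤ (Z₀ s).im := fun s hs ↦ by
    linarith [Loewner.im_centredMap_antitone W₀.continuous hw hs hbT]
  -- the rate is uniformly continuous on a compact set of values away from `0`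
  set K : Set ℂ := {Z : ℂ | a ≤ Z.im} ∩ Metric.closedBall 0 (R + 1) with hK
  have hKc : IsCompact K :=
    (isCompact_closedBall (0 : ℂ) (R + 1)).inter_left
      (isClosed_le continuous_const Complex.continuous_im)
  have hK0 : ∀ Z ∈ K, Z ≠ 0 := by
    rintro Z ⟨hZ, -⟩ rfl
    simp only [mem_setOf_eq, Complex.zero_im] at hZ
    linarith
  have hfc : ContinuousOn (fun Z : ℂ ↦ 4 * Z.im ^ 2 / ‖Z‖ ^ 4) K :=
    (continuousOn_const.mul ((Complex.continuous_im.comp_continuousOn continuousOn_id).pow 2)).div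
      (continuousOn_id.norm.pow 4) fun Z hZ ↦ pow_ne_zero 4 (norm_ne_zero_iff.2 (hK0 Z hZ))
  have hfu : ∀ ε > 0, ∃ δ > 0, ∀ x ∈ K, ∀ y ∈ K, dist x y < δ →
      dist (4 * x.im ^ 2 / ‖x‖ ^ 4) (4 * y.im ^ 2 / ‖y‖ ^ 4) < ε :=
    Metric.uniformContinuousOn_iff.1 (hKc.uniformContinuousOn_of_continuous hfc)
  rw [ContinuousAt, Metric.tendsto_nhds]
  intro ε hε
  set ε' : ℝ := ε / 2 / ((b : ℝ) + 1) with hε'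
  have hε'0 : 0 < ε' := by positivity
  obtain ⟨δ, hδ0, hδ⟩ := hfu ε' hε'0
  have h1' := Metric.tendsto_nhds.1 h1 (ε / 2) (half_pos hε)
  have h2 : ∀ᶠ p : ℝ≥0 × C(ℝ≥0, ℝ) in 𝓝 (u₀, W₀), r p < b :=
    hrc.tendsto.eventually (eventually_lt_nhds hr₀b)
  have hη0 : 0 < min (min δ a) 1 := lt_min (lt_min hδ0 ha0) one_pos
  have h3 : ∀ᶠ p : ℝ≥0 × C(ℝ≥0, ℝ) in 𝓝 (u₀, W₀),
      (b : WithTop ℝ≥0) < Loewner.swallowingTime p.2 w ∧ ∀ s : ℝ≥0, s ≤ b →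
        dist (Loewner.centredMap p.2 s w) (Loewner.centredMap W₀ s w) < min (min δ a) 1 :=
    (continuous_snd.tendsto (u₀, W₀)).eventually (eventually_close W₀ w hbT hη0)
  filter_upwards [h1', h2, h3] with p hp1 hp2 hp3
  obtain ⟨hpT, hclose⟩ := hp3
  have hrpT : ((r p : ℝ≥0) : WithTop ℝ≥0) < Loewner.swallowingTime p.2 w :=
    lt_of_le_of_lt (WithTop.coe_le_coe.2 hp2.le) hpT
  have hrpT₀ : ((r p : ℝ≥0) : WithTop ℝ≥0) < Loewner.swallowingTime W₀ w :=
    lt_of_le_of_lt (WithTop.coe_le_coe.2 hp2.le) hbT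
  have hr₀T : ((r (u₀, W₀) : ℝ≥0) : WithTop ℝ≥0) < Loewner.swallowingTime W₀ w :=
    lt_of_le_of_lt (WithTop.coe_le_coe.2 hr₀b.le) hbT
  -- `log ψ` as the integral of the rate
  show dist (Real.log (Loewner.derivRatio p.2 w (r p)))
    (Real.log (Loewner.derivRatio W₀ w (r (u₀, W₀)))) < ε
  rw [Loewner.derivRatio_eq_exp p.2.continuous hw hrpT, Real.log_exp,
    Loewner.derivRatio_eq_exp W₀.continuous hw hr₀T, Real.log_exp]
  have hI₀ : IntervalIntegrable F₀ volume 0 (r p) :=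
    Loewner.intervalIntegrable_derivRatioRate W₀.continuous hrpT₀
  have hI : IntervalIntegrable (Loewner.derivRatioRate p.2 w) volume 0 (r p) :=
    Loewner.intervalIntegrable_derivRatioRate p.2.continuous hrpT
  have hdiff : ‖(∫ s in (0 : ℝ)..(r p), Loewner.derivRatioRate p.2 w s) -
      ∫ s in (0 : ℝ)..(r p), F₀ s‖ ≤ ε' * |((r p : ℝ≥0) : ℝ) - 0| := by
    rw [← intervalIntegral.integral_sub hI hI₀]
    refine intervalIntegral.norm_integral_le_of_norm_le_const fun s hs ↦ ?_
    rw [uIoc_of_le (r p).coe_nonneg] at hs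
    have hs0 : 0 ≤ s := hs.1.le
    have hsb : s.toNNReal ≤ b := by
      rw [← NNReal.coe_le_coe, Real.coe_toNNReal s hs0]
      exact hs.2.trans (NNReal.coe_le_coe.2 hp2.le)
    have hd := hclose _ hsb
    rw [Loewner.derivRatioRate_eq_centredMap, hF₀, Loewner.derivRatioRate_eq_centredMap,
      Real.norm_eq_abs, ← Real.dist_eq]
    refine (hδ _ ⟨?_, ?_⟩ _ ⟨?_, ?_⟩ ?_).le
    · have h4 := abs_im_sub_im_lt (hd.trans_le ((min_le_left _ _).trans (min_le_right _ _)))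
      show a ≤ (Loewner.centredMap p.2 s.toNNReal w).im
      linarith [hIm _ hsb, (abs_lt.1 h4).1]
    · rw [Metric.mem_closedBall, dist_zero_right]
      calc ‖Loewner.centredMap p.2 s.toNNReal w‖
          ≤ ‖Z₀ s.toNNReal‖ + dist (Loewner.centredMap p.2 s.toNNReal w) (Z₀ s.toNNReal) := by
            rw [dist_eq_norm]
            exact norm_le_norm_add_norm_sub' _ _
        _ ≤ R + 1 := add_le_add (hR' _ hsb) (hd.trans_le (min_le_right _ _)).le
    · exact le_trans (by linarith) (hIm _ hsb)
    · rw [Metric.mem_closedBall, dist_zero_right]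
      linarith [hR' _ hsb]
    · exact hd.trans_le ((min_le_left _ _).trans (min_le_left _ _))
  calc dist (∫ s in (0 : ℝ)..(r p), Loewner.derivRatioRate p.2 w s) (P (r (u₀, W₀)))
      ≤ dist (∫ s in (0 : ℝ)..(r p), Loewner.derivRatioRate p.2 w s) (P (r p)) +
          dist (P (r p)) (P (r (u₀, W₀))) := dist_triangle _ _ _
    _ < ε / 2 + ε / 2 := by
        refine add_lt_add_of_le_of_lt ?_ hp1
        rw [dist_eq_norm]
        refine hdiff.trans ?_
        rw [sub_zero, abs_of_nonneg (r p).coe_nonneg]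
        have hrb : ((r p : ℝ≥0) : ℝ) ≤ (b : ℝ) + 1 := by linarith [NNReal.coe_le_coe.2 hp2.le]
        calc ε' * ((r p : ℝ≥0) : ℝ) ≤ ε' * ((b : ℝ) + 1) := mul_le_mul_of_nonneg_left hrb hε'0.le
          _ = ε / 2 := by rw [hε']; field_simp
    _ = ε := add_halves ε

/-! ## The registered stub -/

/-- **`RoomObsFunctional`** (registered stub `stub_roomObsFunctional` of the line
`room-entropy-wright-fisher`, crux `SubseqIdentification`, stmt-CriticalPhenomena-0783): for
`w ∈ ℍ` and a cap `m`, the stopped room–entropy observable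
`(u, W) ↦ N^{w,m}_u(W) = roomObsStopped W w m u` is jointly continuous on
`[0, ∞) × C([0, ∞), ℝ)` (stopped centred flow and stopped `log ψ` jointly continuous,
`continuous_centredMap_stopped`, `continuous_log_derivRatio_stopped`; the flow never vanishes
up to the room stop, so Schramm's observable `(1 + Re z/|z|)/2` and the binary entropy compose
continuously), and bounded by `2 log (m+1) + 3 log 2` for every continuous driving function
(`Loewner.abs_roomObs_min_roomStop_le`). These are the hypotheses `hN`, `hNC` of
`Loewner.integral_cylinder_eq_zero_of_tendstoInDistribution` for
`N u W := roomObsStopped W w m u`. -/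
theorem stub_roomObsFunctional :
    ∀ w : ℂ, 0 < w.im → ∀ m : ℕ,
      Continuous (fun p : ℝ≥0 × C(ℝ≥0, ℝ) => roomObsStopped p.2 w m p.1) ∧
      ∀ W : ℝ≥0 → ℝ, Continuous W → ∀ u : ℝ≥0,
        |roomObsStopped W w m u| ≤ 2 * Real.log ((m : ℝ) + 1) + 3 * Real.log 2 := by
  intro w hw m
  refine ⟨?_, fun W hW u ↦ Loewner.abs_roomObs_min_roomStop_le hW hw m u⟩
  have hZ := continuous_centredMap_stopped hw m
  have hL := continuous_log_derivRatio_stopped hw m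
  have hne : ∀ p : ℝ≥0 × C(ℝ≥0, ℝ),
      Loewner.centredMap p.2 (min p.1 (roomStop p.2 w m)) w ≠ 0 := fun p ↦
    Loewner.centredMap_ne_zero p.2.continuous hw
      (Loewner.coe_lt_swallowingTime_of_le_roomStop p.2.continuous hw m (min_le_right _ _))
  have hS : Continuous fun p : ℝ≥0 × C(ℝ≥0, ℝ) ↦
      Loewner.schrammObs p.2 w (min p.1 (roomStop p.2 w m)) := by
    show Continuous fun p : ℝ≥0 × C(ℝ≥0, ℝ) ↦
      (1 + (Loewner.centredMap p.2 (min p.1 (roomStop p.2 w m)) w).re /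
        ‖Loewner.centredMap p.2 (min p.1 (roomStop p.2 w m)) w‖) / 2
    exact (continuous_const.add ((Complex.continuous_re.comp hZ).div hZ.norm fun p ↦
      norm_ne_zero_iff.2 (hne p))).div_const _
  show Continuous fun p : ℝ≥0 × C(ℝ≥0, ℝ) ↦
    Real.log (Loewner.derivRatio p.2 w (min p.1 (roomStop p.2 w m))) +
      3 * Real.binEntropy (Loewner.schrammObs p.2 w (min p.1 (roomStop p.2 w m)))
  exact hL.add (continuous_const.mul (Real.binEntropy_continuous.comp hS))

end Summit.CriticalPhenomena.SAWScalingLimit.Theorems.SubseqIdentification.RoomEntropy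

end
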